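import Summits.BirchSwinnertonDyer.BirchSwinnertonDyer.Theorems.ByReductionTypeAtTwoOrdKatoHalfAtTwoIsoRelaxedRoadsLemma46
import Summits.BirchSwinnertonDyer.BirchSwinnertonDyer.Theorems.ByReductionTypeAtTwoOrdKatoHalfAtTwoIsoPosDiscSplit
import Summits.BirchSwinnertonDyer.BirchSwinnertonDyer.Theorems.ByReductionTypeAtTwoOrdKatoHalfAtTwoIsoPosDiscEpsilon
import Summits.BirchSwinnertonDyer.BirchSwinnertonDyer.Theorems.ByReductionTypeAtTwoOrdKatoHalfAtTwoIsoOptimalOff514Defs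
import Literature.NumberTheory.EllipticCurves.KatoRankBoundProofs
import Literature.NumberTheory.EllipticCurves.FineSelmerLimThm35AtTwoUpstairsProofs
import Literature.NumberTheory.EllipticCurves.IwasawaSelmerDualProofs
import Literature.NumberTheory.EllipticCurves.KatoFineSelmerDualProofs
import Literature.NumberTheory.EllipticCurves.IwasawaSelmerRelaxedAtInfinity
import Literature.NumberTheory.EllipticCurves.KatoFineSelmerDualRelaxedAtInfinity
import HarnessLib

/-!
# Cert47 (crux-triage r1 seat 2/2, GEN 47) — REGISTRATION READ of the lead's skeleton OF RECORD **v20**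
# `Lines/steinberg_fibre_at_two.lean` (sha256 5463f38a…, registered 2026-08-29T13:33:12Z by cruxlead-19573 g8; SEVEN stubs:
# `stub_ZCmu_iota_negDisc` · `stub_colemanMu_spanFree_posDisc` · `stub_conjA_two_posDisc` · `stub_bundle` · `stub_relaxedZetaOptimal_existsMember_flat` ·
# `stub_limFW` · `stub_lemma46`) — and of the v19 skeleton it superseded after 2 min 39 s (sha256 f0b4a397…, 13:30:33Z; same first six stubs,
# seventh = `stub_lemma46_limUp : h46 ∧ Lim@2-upstairs`) — for the crux `OrdKatoHalfAtTwoIso` (stmt-BirchSwinnertonDyer-19573), line `steinberg-fibre-at-two`.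

Refuter-grade certificate, CONDITIONAL on its displayed hypotheses; nothing asserted, nothing landed; the crux, its three open
K4 children (24097 · 23921 · 23889) and every memo / research stub remain OPEN; BSD is NOT proved by any of this.

What is checked here (kernel, tree-landed imports only; no module of the `Cruxes/` work area is imported):
* §0 NON-VACUITY of the one-variable frames every registered stub and the crux quantify over at `p = 2`
  (`κ : ZpExtension ℚ 2` cyclotomic, `γ` a topological generator matching the cyclotomic variable, and the four Selmer-dual data
  types — strict / fine / relaxed-at-`∞` / fine-relaxed-at-`∞` — for every `W`), by NAME from tree theorems. (Director (393)(2) probe: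
  none of the seven stub texts mentions a two-variable frame `IsGreenbergLFunctionAnyRoot₂` / `IsTopGeneratorPair` / `XGr₂` /
  `IsKatzMeasure₂` — one-variable cyclotomic statements throughout; «faithful at 2».)
* §1 IDENTITY BY NAME: the seven registered v20 stub TYPES (short names exactly as they stand in the item JSON `stubs[]`, elaborated in the
  skeleton's `open` context reproduced below) are `Iff.rfl`-identical to the fully qualified tree declarations of record (v19's seventh too).
* §2 JOINT SUFFICIENCY of the REGISTERED v20 7-tuple: the crux BY NAME from the seven stub types as hypotheses — the skeleton's own
  composition `OrdKatoHalfAtTwoIso_of` with `sorry`-stubs replaced by hypotheses (so `#print axioms` is meaningful); the Lim@2-UPSTAIRS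
  input of the B7 door is the KERNEL theorem `Lim2017.…_holds` (w2 p716773) BY NAME, exactly as in v20's `B7_of_stubs`; v19's tuple as a corollary.
* §3 the CONSUMED sub-multiset: the same conclusion WITHOUT `stub_bundle.2.2` (Greenberg 5.14@2) and WITHOUT `stub_limFW.1`
  (Lim 2017 Thm 3.5 at 2 DOWNSTAIRS) — both registered print conjuncts are IDLE for this composition (information; VARIANT-N business):
  consumed = F1μι⁻ · P⁺ · Q⁺ · PUB (Kato 17.4 (1)(2)@2 only) · Abbes–Ullmo · R-opt∃♭ · Ferrero–Washington · h46 (+ kernel Lim-up).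
* §4 the two open K4 children BY NAME over the registered stubs: 24097 `OrdKatoFineZetaAtTwoResidue` (pair) and 23921's text
  `KatoMuPartOff514AtOptimalMemberOfNotSurjectiveTwo` (B7′) — exactly the «registered stubs ↔ K4 children» map of the skeleton docstring.

References: tree p714697 (`…RelaxedRoadsLemma46`), p711951 (`…RelaxedOptimalExistsMember`), `…PosDiscSplit`, `…PosDiscEpsilon`,
`…OptimalOff514Defs`; `KatoRankBoundProofs` (`exists_isCyclotomic_isTopGenerator_isCyclotomicVariable_holds`). [GreenbergLNM1716] §1, §4 L.4.6;
[Kato2004Asterisque] Thm 17.4; [Lim2017FineSelmer] Thm 3.5; [FerreroWashington1979]; [AbbesUllmo1996] Thm A.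
-/

set_option autoImplicit false
set_option linter.dupNamespace false

noncomputable section

open scoped Classical MatrixGroups ModularForm NumberField
open CongruenceSubgroup WeierstrassCurve Field IsDedekindDomain
open Literature.NumberTheory.GaloisRepresentations
open Literature.NumberTheory.EllipticCurves Literature.NumberTheory.EllipticCurves.ModularForms
open Literature.NumberTheory.EllipticCurves.Kato2004
open Literature.NumberTheory.EllipticCurves.Rank1Residual
open Summit.BirchSwinnertonDyer.Rank1Residual Summit.BirchSwinnertonDyer.Rank1Residual.X5
open Summit.BirchSwinnertonDyer.BirchSwinnertonDyer.Theorems.OrdKatoOptimalAtTwo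
open Summit.BirchSwinnertonDyer.BirchSwinnertonDyer.Theses.ByReductionTypeAtTwo
open Summit.BirchSwinnertonDyer.BirchSwinnertonDyer.Theorems.SteinbergFibreAtTwo
open Literature.NumberTheory.EllipticCurves.Greenberg1999 Literature.NumberTheory.IwasawaTheory

namespace Summit.BirchSwinnertonDyer.BirchSwinnertonDyer.Cruxes.OrdKatoHalfAtTwoIso.Cert47

/-! ### §0 Non-vacuity of the one-variable frames at `p = 2` (by name) -/

/-- The cyclotomic one-variable frame at `p = 2` over `ℚ` is INHABITED together with all four Selmer-dual data types of any curve: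
the `∀ κ γ (hκ) (hγ) (hγ') (D) (Y) (Dr) (Yr), …` binders of the seven registered stubs and of the crux quantify over non-empty types.
[cite: Washington1997, §13.1] [cite: GreenbergLNM1716, §1 (after Conj. 1.3)] -/
theorem frames_at_two_inhabited (W : WeierstrassCurve ℚ) [W.IsElliptic] :
    ∃ (κ : ZpExtension ℚ 2) (γ : absoluteGaloisGroup ℚ),
      κ.IsCyclotomic ∧ κ.IsTopGenerator γ ∧ IsCyclotomicVariable 2 γ ∧
        Nonempty (W.SelmerDualData κ γ) ∧ Nonempty (W.FineSelmerDualData κ γ) ∧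
          Nonempty (W.SelmerDualDataRelaxedInf κ γ) ∧ Nonempty (W.FineSelmerDualDataRelaxedInf κ γ) := by
  obtain ⟨κ, hκ, γ, hγ, hγ'⟩ := exists_isCyclotomic_isTopGenerator_isCyclotomicVariable_holds 2
  exact ⟨κ, γ, hκ, hγ, hγ', W.nonempty_selmerDualData_holds κ γ hγ, W.nonempty_fineSelmerDualData κ hγ,
    W.nonempty_selmerDualDataRelaxedInf κ hγ, W.nonempty_fineSelmerDualDataRelaxedInf κ hγ⟩

/-! ### §1 The seven registered stub types, by name -/

theorem s1_byName : ZetaColemanMuIotaNegDiscAtTwo ↔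
    Summit.BirchSwinnertonDyer.BirchSwinnertonDyer.Theorems.SteinbergFibreAtTwo.ZetaColemanMuIotaNegDiscAtTwo := Iff.rfl

theorem s2_byName : ColemanMuSpanFreeIotaPosDiscAtTwo ↔
    Summit.BirchSwinnertonDyer.BirchSwinnertonDyer.Theorems.SteinbergFibreAtTwo.ColemanMuSpanFreeIotaPosDiscAtTwo := Iff.rfl

theorem s3_byName : FineSelmerConjATwoOrdPosDisc ↔
    Summit.BirchSwinnertonDyer.BirchSwinnertonDyer.Theorems.SteinbergFibreAtTwo.FineSelmerConjATwoOrdPosDisc := Iff.rfl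

theorem s4_byName :
    (Literature.Uncategorized.OrdPublishedInputsAtTwo ∧ abbesUllmo_not_dvd_maninConstant_of_not_dvd_level ∧
        Literature.NumberTheory.EllipticCurves.Greenberg1999.prop514_isTorsion_mu_eq_zero_two) ↔
      (Summit.BirchSwinnertonDyer.BirchSwinnertonDyer.Theses.ByReductionTypeAtTwo.OrdPublishedInputsAtTwo ∧
        Literature.NumberTheory.EllipticCurves.ModularForms.abbesUllmo_not_dvd_maninConstant_of_not_dvd_level ∧
          Literature.NumberTheory.EllipticCurves.Greenberg1999.prop514_isTorsion_mu_eq_zero_two) := Iff.rfl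

theorem s5_byName : RelaxedZetaOptimalAtTwoExistsMemberFlat ↔
    Summit.BirchSwinnertonDyer.BirchSwinnertonDyer.Theorems.SteinbergFibreAtTwo.RelaxedZetaOptimalAtTwoExistsMemberFlat := Iff.rfl

theorem s6_byName :
    (Lim2017.thm35_at_two_fineSelmerDual_moduleFinite_of_classicalMuVanishes_of_le_divisionField_four ∧
        Literature.NumberTheory.IwasawaTheory.ferreroWashington1979_classicalMuVanishes) ↔
      (Literature.NumberTheory.EllipticCurves.Lim2017.thm35_at_two_fineSelmerDual_moduleFinite_of_classicalMuVanishes_of_le_divisionField_four ∧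
        Literature.NumberTheory.IwasawaTheory.ferreroWashington1979_classicalMuVanishes) := Iff.rfl

/-- v20's seventh stub `stub_lemma46` (h46 ALONE). -/
theorem s7_byName : Greenberg1999.lemma46_relaxed_mod_selmer_infinite_rat_two ↔
    Literature.NumberTheory.EllipticCurves.Greenberg1999.lemma46_relaxed_mod_selmer_infinite_rat_two := Iff.rfl

/-- v19's (superseded) seventh stub `stub_lemma46_limUp` (h46 ∧ Lim@2-upstairs). -/
theorem s7_v19_byName :
    (Greenberg1999.lemma46_relaxed_mod_selmer_infinite_rat_two ∧
        Lim2017.thm35_at_two_upstairs_fineSelmer_twoTorsion_finite_of_classicalMuVanishes) ↔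
      (Literature.NumberTheory.EllipticCurves.Greenberg1999.lemma46_relaxed_mod_selmer_infinite_rat_two ∧
        Literature.NumberTheory.EllipticCurves.Lim2017.thm35_at_two_upstairs_fineSelmer_twoTorsion_finite_of_classicalMuVanishes) :=
  Iff.rfl

/-- The Lim@2-UPSTAIRS conjunct v20 dropped from the registered list is a KERNEL theorem (closed by name; = triage-2 `LimUpCheck45`). -/
theorem limUp_kernel : Lim2017.thm35_at_two_upstairs_fineSelmer_twoTorsion_finite_of_classicalMuVanishes :=
  Lim2017.thm35_at_two_upstairs_fineSelmer_twoTorsion_finite_of_classicalMuVanishes_holds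

/-- The crux decl of the item, by name (the skeleton's `OrdKatoHalfAtTwoIso` short name is the Theses decl). -/
theorem crux_byName : OrdKatoHalfAtTwoIso ↔
    Summit.BirchSwinnertonDyer.BirchSwinnertonDyer.Theses.ByReductionTypeAtTwo.OrdKatoHalfAtTwoIso := Iff.rfl

/-! ### §2 Joint sufficiency of the REGISTERED 7-tuple (the skeleton's composition, stubs ↦ hypotheses) -/

/-- Kato 17.4 (1)(2) at `2` = third conjunct of PUB (extraction, as in the skeleton's `kato1712_at_two_of_pub`). -/
theorem kato1712_at_two_of_pub (hPub : Summit.BirchSwinnertonDyer.BirchSwinnertonDyer.Theses.ByReductionTypeAtTwo.OrdPublishedInputsAtTwo) :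
    ∀ (V : WeierstrassCurve ℚ) [V.IsElliptic] [V.IsGloballyMinimal] [NeZero (V.conductorNorm ℤ)]
      (f : CuspForm (Gamma0 (V.conductorNorm ℤ)) 2), kato_divisibility_allPrimes V 2 (f := f) := by
  obtain ⟨_, _, h17, _⟩ := hPub
  exact h17

/-- **The crux BY NAME from the seven REGISTERED v20 stub types** (s1 F1μι⁻ · s2 P⁺ · s3 Q⁺ · s4 bundle · s5 R-opt∃♭ · s6 Lim-down ∧ FW ·
s7 h46) — literally the v20 skeleton's `OrdKatoHalfAtTwoIso_of` / `posDisc_of_stubs` / `B7_of_stubs` with hypotheses for stubs and the kernel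
theorem `Lim2017.…_holds` for the B7 door's Lim@2-UPSTAIRS input. CONDITIONAL; nothing closed. -/
theorem ordKatoHalfAtTwoIso_of_v20_registered
    (s1 : ZetaColemanMuIotaNegDiscAtTwo) (s2 : ColemanMuSpanFreeIotaPosDiscAtTwo) (s3 : FineSelmerConjATwoOrdPosDisc)
    (s4 : Literature.Uncategorized.OrdPublishedInputsAtTwo ∧ abbesUllmo_not_dvd_maninConstant_of_not_dvd_level ∧
      Literature.NumberTheory.EllipticCurves.Greenberg1999.prop514_isTorsion_mu_eq_zero_two)
    (s5 : RelaxedZetaOptimalAtTwoExistsMemberFlat)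
    (s6 : Lim2017.thm35_at_two_fineSelmerDual_moduleFinite_of_classicalMuVanishes_of_le_divisionField_four ∧
      Literature.NumberTheory.IwasawaTheory.ferreroWashington1979_classicalMuVanishes)
    (s7 : Greenberg1999.lemma46_relaxed_mod_selmer_infinite_rat_two) :
    Summit.BirchSwinnertonDyer.BirchSwinnertonDyer.Theses.ByReductionTypeAtTwo.OrdKatoHalfAtTwoIso :=
  have h17 := kato1712_at_two_of_pub s4.1
  ordKatoHalfAtTwoIso_of_iota_halves_B7 s1 (ordKatoHalfAtTwoIsoPosDisc_of_epsilon s2 s3 s4.2.1 h17) s4.2.1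
    (katoMuPartAtOptimalMember_of_existsMemberFlat_of_lemma46 limUp_kernel s6.2 s5 s7 h17) h17

/-- The superseded v19 7-tuple (seventh stub `h46 ∧ Lim-up`) gives the crux a fortiori. CONDITIONAL; nothing closed. -/
theorem ordKatoHalfAtTwoIso_of_v19_registered
    (s1 : ZetaColemanMuIotaNegDiscAtTwo) (s2 : ColemanMuSpanFreeIotaPosDiscAtTwo) (s3 : FineSelmerConjATwoOrdPosDisc)
    (s4 : Literature.Uncategorized.OrdPublishedInputsAtTwo ∧ abbesUllmo_not_dvd_maninConstant_of_not_dvd_level ∧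
      Literature.NumberTheory.EllipticCurves.Greenberg1999.prop514_isTorsion_mu_eq_zero_two)
    (s5 : RelaxedZetaOptimalAtTwoExistsMemberFlat)
    (s6 : Lim2017.thm35_at_two_fineSelmerDual_moduleFinite_of_classicalMuVanishes_of_le_divisionField_four ∧
      Literature.NumberTheory.IwasawaTheory.ferreroWashington1979_classicalMuVanishes)
    (s7 : Greenberg1999.lemma46_relaxed_mod_selmer_infinite_rat_two ∧
      Lim2017.thm35_at_two_upstairs_fineSelmer_twoTorsion_finite_of_classicalMuVanishes) :
    Summit.BirchSwinnertonDyer.BirchSwinnertonDyer.Theses.ByReductionTypeAtTwo.OrdKatoHalfAtTwoIso :=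
  ordKatoHalfAtTwoIso_of_v20_registered s1 s2 s3 s4 s5 s6 s7.1

/-! ### §3 The CONSUMED sub-multiset (5.14@2 and Lim-downstairs idle) -/

/-- Same conclusion from the EIGHT consumed conjuncts only: F1μι⁻, P⁺, Q⁺, PUB, Abbes–Ullmo, R-opt∃♭, Ferrero–Washington, h46 (Lim@2-upstairs
entering as the kernel theorem). Greenberg 5.14@2 and Lim 2017 Thm 3.5 at 2 DOWNSTAIRS do not occur. CONDITIONAL; nothing closed. -/
theorem ordKatoHalfAtTwoIso_of_v20_consumed
    (s1 : ZetaColemanMuIotaNegDiscAtTwo) (s2 : ColemanMuSpanFreeIotaPosDiscAtTwo) (s3 : FineSelmerConjATwoOrdPosDisc)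
    (hPub : Summit.BirchSwinnertonDyer.BirchSwinnertonDyer.Theses.ByReductionTypeAtTwo.OrdPublishedInputsAtTwo)
    (hAU : abbesUllmo_not_dvd_maninConstant_of_not_dvd_level)
    (s5 : RelaxedZetaOptimalAtTwoExistsMemberFlat)
    (hFW : Literature.NumberTheory.IwasawaTheory.ferreroWashington1979_classicalMuVanishes)
    (h46 : Greenberg1999.lemma46_relaxed_mod_selmer_infinite_rat_two) :
    Summit.BirchSwinnertonDyer.BirchSwinnertonDyer.Theses.ByReductionTypeAtTwo.OrdKatoHalfAtTwoIso :=
  have h17 := kato1712_at_two_of_pub hPub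
  ordKatoHalfAtTwoIso_of_iota_halves_B7 s1 (ordKatoHalfAtTwoIsoPosDisc_of_epsilon s2 s3 hAU h17) hAU
    (katoMuPartAtOptimalMember_of_existsMemberFlat_of_lemma46 limUp_kernel hFW s5 h46 h17) h17

/-! ### §4 The open K4 children BY NAME over the registered stubs -/

/-- Child 24097 `OrdKatoFineZetaAtTwoResidue` (the PAIR) from s1 · s2 · s3 · s4 (PUB, AU) — the skeleton's `pair_of_stubs`. -/
theorem child24097_of_v20_registered
    (s1 : ZetaColemanMuIotaNegDiscAtTwo) (s2 : ColemanMuSpanFreeIotaPosDiscAtTwo) (s3 : FineSelmerConjATwoOrdPosDisc)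
    (s4 : Literature.Uncategorized.OrdPublishedInputsAtTwo ∧ abbesUllmo_not_dvd_maninConstant_of_not_dvd_level ∧
      Literature.NumberTheory.EllipticCurves.Greenberg1999.prop514_isTorsion_mu_eq_zero_two) :
    Summit.BirchSwinnertonDyer.BirchSwinnertonDyer.Theses.ByReductionTypeAtTwo.OrdKatoFineZetaAtTwoResidue :=
  ordKatoFineZetaAtTwoResidue_of_negDisc_of_epsilon s1 s2 s3 s4.2.1 (kato1712_at_two_of_pub s4.1)

/-- Child 23921's text B7′ `KatoMuPartOff514AtOptimalMemberOfNotSurjectiveTwo` from s4.1 (PUB) · s5 · s6.2 (FW) · s7 — the skeleton's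
`B7'_of_stubs` (B7 UNCUT first, then the left disjunct). -/
theorem child23921_of_v20_registered
    (hPub : Summit.BirchSwinnertonDyer.BirchSwinnertonDyer.Theses.ByReductionTypeAtTwo.OrdPublishedInputsAtTwo)
    (s5 : RelaxedZetaOptimalAtTwoExistsMemberFlat)
    (hFW : Literature.NumberTheory.IwasawaTheory.ferreroWashington1979_classicalMuVanishes)
    (s7 : Greenberg1999.lemma46_relaxed_mod_selmer_infinite_rat_two) :
    Summit.BirchSwinnertonDyer.BirchSwinnertonDyer.Theorems.SteinbergFibreAtTwo.KatoMuPartOff514AtOptimalMemberOfNotSurjectiveTwo :=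
  katoMuPartOff514_of_katoMuPartAtOptimalMember
    (katoMuPartAtOptimalMember_of_existsMemberFlat_of_lemma46 limUp_kernel hFW s5 s7 (kato1712_at_two_of_pub hPub))

/-- Child 23921 ITSELF, i.e. the Theses decl `OrdKatoMuPartOptimalAtTwo` (item stmt-BirchSwinnertonDyer-23921, text = B7′ verbatim), BY NAME
over the registered stubs — leaf C's `ordKatoMuPartOptimalAtTwo_of_existsMemberFlat_of_lemma46` (p714697). CONDITIONAL; 23921 is NOT closed. -/
theorem child23921_thesis_of_v20_registered
    (hPub : Summit.BirchSwinnertonDyer.BirchSwinnertonDyer.Theses.ByReductionTypeAtTwo.OrdPublishedInputsAtTwo)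
    (s5 : RelaxedZetaOptimalAtTwoExistsMemberFlat)
    (hFW : Literature.NumberTheory.IwasawaTheory.ferreroWashington1979_classicalMuVanishes)
    (s7 : Greenberg1999.lemma46_relaxed_mod_selmer_infinite_rat_two) :
    Summit.BirchSwinnertonDyer.BirchSwinnertonDyer.Theses.ByReductionTypeAtTwo.OrdKatoMuPartOptimalAtTwo :=
  ordKatoMuPartOptimalAtTwo_of_existsMemberFlat_of_lemma46 limUp_kernel hFW s5 s7 (kato1712_at_two_of_pub hPub)

/-- Child 23889 `OrdKatoIsoPrintBundleAtTwo` (support item; its registered signature is the bundle text) is `stub_bundle` verbatim. -/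
theorem child23889_is_s4 :
    (Literature.Uncategorized.OrdPublishedInputsAtTwo ∧ abbesUllmo_not_dvd_maninConstant_of_not_dvd_level ∧
        Literature.NumberTheory.EllipticCurves.Greenberg1999.prop514_isTorsion_mu_eq_zero_two) ↔
      (Literature.Uncategorized.OrdPublishedInputsAtTwo ∧
        Literature.NumberTheory.EllipticCurves.ModularForms.abbesUllmo_not_dvd_maninConstant_of_not_dvd_level ∧
          Literature.NumberTheory.EllipticCurves.Greenberg1999.prop514_isTorsion_mu_eq_zero_two) := Iff.rfl

end Summit.BirchSwinnertonDyer.BirchSwinnertonDyer.Cruxes.OrdKatoHalfAtTwoIso.Cert47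

end
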